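import Mathlib
import Summits.ResolutionOfSingularities.ResolutionOfSingularities.Theorems.WeightedInvariantLocalWeightedDropNCResRegimesOfBudget

/-!
# `LocalWeightedDrop`, TOT2-LINE inner S-ASM (12): THE (P)/(L) ASSEMBLIES WITH A BUDGET VALUED IN ANY WELL-ORDERED TYPE
Crux item stmt-ResolutionOfSingularities-8899, ENGINE skeleton v35 (2e806da509994632), stub `stub_conflictBudget` ((P3)).  [OURS · L1 W4.3 · seat
res-L1-w43-lead-1 gen 5; def-free; …NCResRegimePresentedAssembly (p547539) / …NCResRegimeLetterAssembly (p552428) VERBATIM with `M` valued in a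
linear order `β` with well-founded `<` (lexicographic budgets); phase measure `Λ · typein(M) + rank`.  AI-produced, gate-checked, weaker than
expert review; nothing here is a statement of any manuscript.]
-/

set_option linter.dupNamespace false -- mandated namespace of this single-conjunct summit

noncomputable section

namespace Summit.ResolutionOfSingularities.ResolutionOfSingularities.Theorems

namespace TameFourTupleDrop

open MvPowerSeries Literature.AlgebraicGeometry.Resolution PolyDescent

variable {k : Type} [Field k]

/-- **REGIME (P) FROM ITS PIECES, WELL-ORDERED BUDGET** (v1 step shapes). -/
theorem regimePresented_of_pieces_wf [Infinite k]
    (ψsel : (d : ℕ) → (Fin d → MvPowerSeries (Fin 2) k) → MvPowerSeries (Fin 2) k)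
    (hsel : ∀ (d : ℕ) (X : Fin d → MvPowerSeries (Fin 2) k), IsPosT d X → IsPrepRecentring d X (ψsel d X))
    {β : Type} [LinearOrder β] [IsWellOrder β (· < ·)] (M : (d : ℕ) → (Fin d → MvPowerSeries (Fin 2) k) → Finset (Fin 2) → β)
    (hM_succ : ∀ (d : ℕ) (A : Fin d → MvPowerSeries (Fin 2) k) (N : Finset (Fin 2)) (A' : Fin d → MvPowerSeries (Fin 2) k)
      (N' : Finset (Fin 2)),
      (∃ (b : MvPowerSeries (Fin (2 + 1)) k) (δ : Decoration k 2) (Θ : Fin (2 + 1) → MvPowerSeries (Fin (2 + 1)) k),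
        Admissible b δ ∧ 2 ≤ δ.o ∧ δ.c = d ∧ δ.PresBy d A N Θ) →
      InPoly d A → InPoly d A' → SuccFamilySel d (ψsel d) A N A' N' → M d A' N' ≤ M d A N)
    (hM_conf : ∀ (d : ℕ) (A : Fin d → MvPowerSeries (Fin 2) k) (N : Finset (Fin 2)) (A' : Fin d → MvPowerSeries (Fin 2) k)
      (N' : Finset (Fin 2)),
      (∃ (b : MvPowerSeries (Fin (2 + 1)) k) (δ : Decoration k 2) (Θ : Fin (2 + 1) → MvPowerSeries (Fin (2 + 1)) k),
        Admissible b δ ∧ 2 ≤ δ.o ∧ δ.c = d ∧ δ.PresBy d A N Θ) →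
      InPoly d A → InPoly d A' → NCPoly.Conflict d A N → PointFamilySel d (ψsel d) A N A' N' → M d A' N' < M d A N)
    (hP1 : ∀ (b : MvPowerSeries (Fin (2 + 1)) k) (δ : Decoration k 2), Admissible b δ → 2 ≤ δ.o → ¬ δ.HCol →
      (δ.O.Nonempty ∨ δ.GoodDir) →
      ∃ (A : Fin δ.c → MvPowerSeries (Fin 2) k) (N : Finset (Fin 2)) (Θ : Fin (2 + 1) → MvPowerSeries (Fin (2 + 1)) k),
        δ.PresBy δ.c A N Θ ∧ InPoly δ.c A)
    (hPx : ∀ (b : MvPowerSeries (Fin (2 + 1)) k) (δ : Decoration k 2) (d : ℕ) (A : Fin d → MvPowerSeries (Fin 2) k) (N : Finset (Fin 2))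
      (Θ : Fin (2 + 1) → MvPowerSeries (Fin (2 + 1)) k),
      Admissible b δ → 2 ≤ δ.o → δ.c = d → δ.PresBy d A N Θ → WellPrepared d A → ¬ InPoly d A → δ.HCol)
    (hP2 : ∀ (b : MvPowerSeries (Fin (2 + 1)) k) (δ : Decoration k 2) (d : ℕ) (A : Fin d → MvPowerSeries (Fin 2) k) (N : Finset (Fin 2))
      (Θ : Fin (2 + 1) → MvPowerSeries (Fin (2 + 1)) k),
      Admissible b δ → 2 ≤ δ.o → δ.c = d → δ.PresBy d A N Θ → InPoly d A → ¬ NCPoly.Conflict d A N →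
      ∃ (Φ : Fin (2 + 1) → MvPowerSeries (Fin (2 + 1)) k) (w : Fin (2 + 1) → ℕ), IsCountMove Φ w ∧
        MoveClause b Φ w (fun b' => ∃ δ' : Decoration k 2, Admissible b' δ' ∧ (δ'.head < δ.head ∨ (δ'.head = δ.head ∧ (δ'.HCol ∨
          ∃ (A' : Fin d → MvPowerSeries (Fin 2) k) (N' : Finset (Fin 2)) (Θ' : Fin (2 + 1) → MvPowerSeries (Fin (2 + 1)) k),
            δ'.PresBy d A' N' Θ' ∧ WellPrepared d A' ∧ SuccFamilySel d (ψsel d) A N A' N')))))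
    (hP2c : ∀ (b : MvPowerSeries (Fin (2 + 1)) k) (δ : Decoration k 2) (d : ℕ) (A : Fin d → MvPowerSeries (Fin 2) k) (N : Finset (Fin 2))
      (Θ : Fin (2 + 1) → MvPowerSeries (Fin (2 + 1)) k),
      Admissible b δ → 2 ≤ δ.o → δ.c = d → δ.PresBy d A N Θ → InPoly d A → NCPoly.Conflict d A N →
      ∃ (Φ : Fin (2 + 1) → MvPowerSeries (Fin (2 + 1)) k) (w : Fin (2 + 1) → ℕ), IsCountMove Φ w ∧
        MoveClause b Φ w (fun b' => ∃ δ' : Decoration k 2, Admissible b' δ' ∧ (δ'.head < δ.head ∨ (δ'.head = δ.head ∧ (δ'.HCol ∨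
          ∃ (A' : Fin d → MvPowerSeries (Fin 2) k) (N' : Finset (Fin 2)) (Θ' : Fin (2 + 1) → MvPowerSeries (Fin (2 + 1)) k),
            δ'.PresBy d A' N' Θ' ∧ WellPrepared d A' ∧ PointFamilySel d (ψsel d) A N A' N')))))
    (b : MvPowerSeries (Fin (2 + 1)) k) (δ : Decoration k 2) (hadm : Admissible b δ) (ho : 2 ≤ δ.o) (hnc : ¬ δ.HCol)
    (hreg : δ.O.Nonempty ∨ δ.GoodDir) :
    DWinsTo (St := MvPowerSeries (Fin (2 + 1)) k × Decoration k 2) Prod.fst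
      (fun τ => Admissible τ.1 τ.2 ∧ (τ.2.head < δ.head ∨ (τ.2.head = δ.head ∧ τ.2.HCol))) (b, δ) := by
  classical
  -- the degree of the phase and the entry presentation
  set d : ℕ := δ.c with hd_def
  have hd : 0 < d := by rw [hd_def, Decoration.c]; omega
  obtain ⟨A₀, N₀, Θ₀, hpres₀, hin₀⟩ := hP1 b δ hadm ho hnc hreg
  -- rich states: decorated position + (label, boundary)
  let St : Type := (MvPowerSeries (Fin (2 + 1)) k × Decoration k 2) × ((Fin d → MvPowerSeries (Fin 2) k) × Finset (Fin 2))
  let germ : St → MvPowerSeries (Fin (2 + 1)) k := fun σ => σ.1.1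
  let Q : St → Prop := fun σ => Admissible σ.1.1 σ.1.2 ∧ (σ.1.2.head < δ.head ∨ (σ.1.2.head = δ.head ∧ σ.1.2.HCol))
  let C : Set St := {σ | Admissible σ.1.1 σ.1.2 ∧ σ.1.2.head = δ.head ∧
    (∃ Θ : Fin (2 + 1) → MvPowerSeries (Fin (2 + 1)) k, σ.1.2.PresBy d σ.2.1 σ.2.2 Θ) ∧ InPoly d σ.2.1}
  -- measure: `Λ·M + polyhedron rank`, with `Λ` strictly above every rank (the lexicographic pair `(M, rank)` as one ordinal)
  let rk : (Fin d → MvPowerSeries (Fin 2) k) → Ordinal.{0} := fun A => ((wellFounded_polyRelSel (k := k) hd (hsel d)).apply A).rank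
  let Λ : Ordinal.{0} := (⨆ A, rk A) + 1
  have hΛ : ∀ A, rk A < Λ := fun A => Order.lt_add_one_iff.mpr (le_ciSup (Ordinal.bddAbove_of_small (s := Set.range rk)) A)
  let μ : St → Ordinal.{0} := fun σ => Λ * Ordinal.typein (· < ·) (M d σ.2.1 σ.2.2) + rk σ.2.1
  have hlex : ∀ (t t' : Ordinal.{0}) (A A' : Fin d → MvPowerSeries (Fin 2) k), t' < t ∨ (t' = t ∧ rk A' < rk A) →
      Λ * t' + rk A' < Λ * t + rk A := by
    rintro t t' A A' (ht | ⟨rfl, hr⟩)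
    · have ht' : t' + 1 ≤ t := Order.add_one_le_of_lt ht
      calc Λ * t' + rk A' < Λ * t' + Λ := by
            gcongr
            exact hΛ A'
        _ = Λ * (t' + 1) := by rw [mul_add_one]
        _ ≤ Λ * t := by gcongr
        _ ≤ Λ * t + rk A := le_self_add
    · gcongr
  -- head bookkeeping: a state of the phase has the same `o` and `c`
  have hoc : ∀ δ' : Decoration k 2, δ'.head = δ.head → δ'.o = δ.o ∧ δ'.c = d := by
    intro δ' h
    rw [Decoration.head, Decoration.head, toLex_inj, Prod.ext_iff] at h
    exact ⟨h.1, h.2⟩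
  have hσ₀ : (((b, δ), (A₀, N₀)) : St) ∈ C := ⟨hadm, rfl, ⟨Θ₀, hpres₀⟩, hin₀⟩
  have hwin : DWinsTo germ Q (((b, δ), (A₀, N₀)) : St) := by
    refine DWinsTo.of_measure C μ ?_ hσ₀
    rintro ⟨⟨b₁, δ₁⟩, ⟨A₁, N₁⟩⟩ ⟨hadm₁, hhead₁, ⟨Θ₁, hpres₁⟩, hin₁⟩ -
    obtain ⟨ho₁, hc₁⟩ := hoc δ₁ hhead₁
    have ho₁' : 2 ≤ δ₁.o := by rw [ho₁]; exact ho
    have hctx : ∃ (b : MvPowerSeries (Fin (2 + 1)) k) (δ : Decoration k 2) (Θ : Fin (2 + 1) → MvPowerSeries (Fin (2 + 1)) k),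
        Admissible b δ ∧ 2 ≤ δ.o ∧ δ.c = d ∧ δ.PresBy d A₁ N₁ Θ := ⟨b₁, δ₁, Θ₁, hadm₁, ho₁', hc₁, hpres₁⟩
    -- reading a presented successor with the same head: regime label (continue) or apex column (exit)
    have hread : ∀ (b' : MvPowerSeries (Fin (2 + 1)) k) (δ' : Decoration k 2), Admissible b' δ' → δ'.head = δ.head →
        ∀ (A' : Fin d → MvPowerSeries (Fin 2) k) (N' : Finset (Fin 2)) (Θ' : Fin (2 + 1) → MvPowerSeries (Fin (2 + 1)) k),
        δ'.PresBy d A' N' Θ' → WellPrepared d A' →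
        (M d A' N' < M d A₁ N₁ ∨ (M d A' N' = M d A₁ N₁ ∧ rk A' < rk A₁) ∨ ¬ InPoly d A') →
        ∃ τ' : St, germ τ' = b' ∧ (Q τ' ∨ (τ' ∈ C ∧ μ τ' < μ ((b₁, δ₁), (A₁, N₁)))) := by
      intro b' δ' hadm' hhead' A' N' Θ' hpres' hWP' halt
      obtain ⟨ho', hc'⟩ := hoc δ' hhead'
      by_cases hin' : InPoly d A'
      · rcases halt with hlt | hlt | hnin
        · exact ⟨((b', δ'), (A', N')), rfl, Or.inr ⟨⟨hadm', hhead', ⟨Θ', hpres'⟩, hin'⟩, hlex _ _ _ _ (Or.inl ((Ordinal.typein_lt_typein (· < ·)).mpr hlt))⟩⟩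
        · exact ⟨((b', δ'), (A', N')), rfl, Or.inr ⟨⟨hadm', hhead', ⟨Θ', hpres'⟩, hin'⟩, hlex _ _ _ _ (Or.inr ⟨by rw [hlt.1], hlt.2⟩)⟩⟩
        · exact absurd hin' hnin
      · have hcol' : δ'.HCol := hPx b' δ' d A' N' Θ' hadm' (by rw [ho']; exact ho) hc' hpres' hWP' hin'
        exact ⟨((b', δ'), (A', N')), rfl, Or.inl ⟨hadm', Or.inr ⟨hhead', hcol'⟩⟩⟩
    by_cases hconf : NCPoly.Conflict d A₁ N₁
    · -- the point move at a conflict: the budget drops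
      obtain ⟨Φ, w, hmv, hcl⟩ := hP2c b₁ δ₁ d A₁ N₁ Θ₁ hadm₁ ho₁' hc₁ hpres₁ hin₁ hconf
      refine ⟨Φ, w, hmv, hcl.mono fun b' hb' => ?_⟩
      obtain ⟨δ', hadm', hcase⟩ := hb'
      rcases hcase with hlt | ⟨hhead', hcol' | ⟨A', N', Θ', hpres', hWP', hfam⟩⟩
      · exact ⟨((b', δ'), (A₁, N₁)), rfl, Or.inl ⟨hadm', Or.inl (hhead₁ ▸ hlt)⟩⟩
      · exact ⟨((b', δ'), (A₁, N₁)), rfl, Or.inl ⟨hadm', Or.inr ⟨hhead'.trans hhead₁, hcol'⟩⟩⟩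
      · refine hread b' δ' hadm' (hhead'.trans hhead₁) A' N' Θ' hpres' hWP' ?_
        by_cases hin' : InPoly d A'
        · exact Or.inl (hM_conf d A₁ N₁ A' N' hctx hin₁ hin' hconf hfam)
        · exact Or.inr (Or.inr hin')
    · -- the strategy move off the conflict: budget does not rise, polyhedron rank drops
      obtain ⟨Φ, w, hmv, hcl⟩ := hP2 b₁ δ₁ d A₁ N₁ Θ₁ hadm₁ ho₁' hc₁ hpres₁ hin₁ hconf
      refine ⟨Φ, w, hmv, hcl.mono fun b' hb' => ?_⟩
      obtain ⟨δ', hadm', hcase⟩ := hb'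
      rcases hcase with hlt | ⟨hhead', hcol' | ⟨A', N', Θ', hpres', hWP', hfam⟩⟩
      · exact ⟨((b', δ'), (A₁, N₁)), rfl, Or.inl ⟨hadm', Or.inl (hhead₁ ▸ hlt)⟩⟩
      · exact ⟨((b', δ'), (A₁, N₁)), rfl, Or.inl ⟨hadm', Or.inr ⟨hhead'.trans hhead₁, hcol'⟩⟩⟩
      · refine hread b' δ' hadm' (hhead'.trans hhead₁) A' N' Θ' hpres' hWP' ?_
        by_cases hin' : InPoly d A'
        · have hM := hM_succ d A₁ N₁ A' N' hctx hin₁ hin' hfam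
          have hrel : PolyRelSel d (ψsel d) A' A₁ := ⟨mem_succTSel_of_succFamilySel hfam, hin₁, hin'⟩
          have hrk : rk A' < rk A₁ := ((wellFounded_polyRelSel (k := k) hd (hsel d)).apply A₁).rank_lt_of_rel hrel
          rcases hM.lt_or_eq with hMlt | hMeq
          · exact Or.inl hMlt
          · exact Or.inr (Or.inl ⟨hMeq, hrk⟩)
        · exact Or.inr (Or.inr hin')
  -- project to decorated states
  exact hwin.map (germ := Prod.fst) (germ' := germ) (Q' := Q)
    (Q := fun τ : MvPowerSeries (Fin (2 + 1)) k × Decoration k 2 => Admissible τ.1 τ.2 ∧ (τ.2.head < δ.head ∨ (τ.2.head = δ.head ∧ τ.2.HCol)))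
    Prod.fst (fun _ => rfl) (fun _ hq => hq)

/-- **REGIME (P) FROM ITS PIECES, WELL-ORDERED BUDGET, v2 step shapes.** -/
theorem regimePresented_of_pieces₂_wf [Infinite k]
    (ψsel : (d : ℕ) → (Fin d → MvPowerSeries (Fin 2) k) → MvPowerSeries (Fin 2) k)
    (hsel : ∀ (d : ℕ) (X : Fin d → MvPowerSeries (Fin 2) k), IsPosT d X → IsPrepRecentring d X (ψsel d X))
    {β : Type} [LinearOrder β] [IsWellOrder β (· < ·)] (M : (d : ℕ) → (Fin d → MvPowerSeries (Fin 2) k) → Finset (Fin 2) → β)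
    (hM_succ : ∀ (d : ℕ) (A : Fin d → MvPowerSeries (Fin 2) k) (N : Finset (Fin 2)) (A' : Fin d → MvPowerSeries (Fin 2) k)
      (N' : Finset (Fin 2)),
      (∃ (b : MvPowerSeries (Fin (2 + 1)) k) (δ : Decoration k 2) (Θ : Fin (2 + 1) → MvPowerSeries (Fin (2 + 1)) k),
        Admissible b δ ∧ 2 ≤ δ.o ∧ δ.c = d ∧ δ.PresBy d A N Θ) →
      InPoly d A → InPoly d A' → SuccFamilySel d (ψsel d) A N A' N' → M d A' N' ≤ M d A N)
    (hM_conf : ∀ (d : ℕ) (A : Fin d → MvPowerSeries (Fin 2) k) (N : Finset (Fin 2)) (A' : Fin d → MvPowerSeries (Fin 2) k)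
      (N' : Finset (Fin 2)),
      (∃ (b : MvPowerSeries (Fin (2 + 1)) k) (δ : Decoration k 2) (Θ : Fin (2 + 1) → MvPowerSeries (Fin (2 + 1)) k),
        Admissible b δ ∧ 2 ≤ δ.o ∧ δ.c = d ∧ δ.PresBy d A N Θ) →
      InPoly d A → InPoly d A' → NCPoly.Conflict d A N → PointFamilySel d (ψsel d) A N A' N' → M d A' N' < M d A N)
    (hP1 : ∀ (b : MvPowerSeries (Fin (2 + 1)) k) (δ : Decoration k 2), Admissible b δ → 2 ≤ δ.o → ¬ δ.HCol →
      (δ.O.Nonempty ∨ δ.GoodDir) →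
      ∃ (A : Fin δ.c → MvPowerSeries (Fin 2) k) (N : Finset (Fin 2)) (Θ : Fin (2 + 1) → MvPowerSeries (Fin (2 + 1)) k),
        δ.PresBy δ.c A N Θ ∧ InPoly δ.c A)
    (hPx : ∀ (b : MvPowerSeries (Fin (2 + 1)) k) (δ : Decoration k 2) (d : ℕ) (A : Fin d → MvPowerSeries (Fin 2) k) (N : Finset (Fin 2))
      (Θ : Fin (2 + 1) → MvPowerSeries (Fin (2 + 1)) k),
      Admissible b δ → 2 ≤ δ.o → δ.c = d → δ.PresBy d A N Θ → WellPrepared d A → ¬ InPoly d A → δ.HCol)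
    (hP2' : ∀ (b : MvPowerSeries (Fin (2 + 1)) k) (δ : Decoration k 2) (d : ℕ) (A : Fin d → MvPowerSeries (Fin 2) k) (N : Finset (Fin 2))
      (Θ : Fin (2 + 1) → MvPowerSeries (Fin (2 + 1)) k),
      Admissible b δ → 2 ≤ δ.o → δ.c = d → δ.PresBy d A N Θ → InPoly d A → ¬ NCPoly.Conflict d A N →
      ∃ (Φ : Fin (2 + 1) → MvPowerSeries (Fin (2 + 1)) k) (w : Fin (2 + 1) → ℕ), IsCountMove Φ w ∧
        MoveClause b Φ w (fun b' => ∃ δ' : Decoration k 2, Admissible b' δ' ∧ (δ'.o < δ.o ∨ (δ'.head = δ.head ∧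
          ∃ (A' : Fin d → MvPowerSeries (Fin 2) k) (N' : Finset (Fin 2)) (Θ' : Fin (2 + 1) → MvPowerSeries (Fin (2 + 1)) k),
            δ'.PresBy d A' N' Θ' ∧ WellPrepared d A' ∧ SuccFamilySel d (ψsel d) A N A' N'))))
    (hP2c' : ∀ (b : MvPowerSeries (Fin (2 + 1)) k) (δ : Decoration k 2) (d : ℕ) (A : Fin d → MvPowerSeries (Fin 2) k) (N : Finset (Fin 2))
      (Θ : Fin (2 + 1) → MvPowerSeries (Fin (2 + 1)) k),
      Admissible b δ → 2 ≤ δ.o → δ.c = d → δ.PresBy d A N Θ → InPoly d A → NCPoly.Conflict d A N →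
      ∃ (Φ : Fin (2 + 1) → MvPowerSeries (Fin (2 + 1)) k) (w : Fin (2 + 1) → ℕ), IsCountMove Φ w ∧
        MoveClause b Φ w (fun b' => ∃ δ' : Decoration k 2, Admissible b' δ' ∧ (δ'.o < δ.o ∨ (δ'.head = δ.head ∧
          ∃ (A' : Fin d → MvPowerSeries (Fin 2) k) (N' : Finset (Fin 2)) (Θ' : Fin (2 + 1) → MvPowerSeries (Fin (2 + 1)) k),
            δ'.PresBy d A' N' Θ' ∧ WellPrepared d A' ∧ PointFamilySel d (ψsel d) A N A' N'))))
    (b : MvPowerSeries (Fin (2 + 1)) k) (δ : Decoration k 2) (hadm : Admissible b δ) (ho : 2 ≤ δ.o) (hnc : ¬ δ.HCol)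
    (hreg : δ.O.Nonempty ∨ δ.GoodDir) :
    DWinsTo (St := MvPowerSeries (Fin (2 + 1)) k × Decoration k 2) Prod.fst
      (fun τ => Admissible τ.1 τ.2 ∧ (τ.2.head < δ.head ∨ (τ.2.head = δ.head ∧ τ.2.HCol))) (b, δ) := by
  have hlt : ∀ δ δ' : Decoration k 2, δ'.o < δ.o → δ'.head < δ.head := fun δ δ' h => by
    rw [Decoration.head, Decoration.head, Prod.Lex.toLex_lt_toLex]; exact Or.inl h
  refine regimePresented_of_pieces_wf ψsel hsel M hM_succ hM_conf hP1 hPx (fun b δ d A N Θ hadm ho hc hpres hin hconf => ?_)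
    (fun b δ d A N Θ hadm ho hc hpres hin hconf => ?_) b δ hadm ho hnc hreg
  · obtain ⟨Φ, w, hmv, hcl⟩ := hP2' b δ d A N Θ hadm ho hc hpres hin hconf
    refine ⟨Φ, w, hmv, hcl.mono fun b' ⟨δ', hadm', hcase⟩ => ⟨δ', hadm', ?_⟩⟩
    exact hcase.imp (hlt δ δ') fun h => ⟨h.1, Or.inr h.2⟩
  · obtain ⟨Φ, w, hmv, hcl⟩ := hP2c' b δ d A N Θ hadm ho hc hpres hin hconf
    refine ⟨Φ, w, hmv, hcl.mono fun b' ⟨δ', hadm', hcase⟩ => ⟨δ', hadm', ?_⟩⟩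
    exact hcase.imp (hlt δ δ') fun h => ⟨h.1, Or.inr h.2⟩

/-- **REGIME (L) FROM THE PIECES OF REGIME (P), WELL-ORDERED BUDGET** (v2 step shapes). -/
theorem regimeLetter_of_pieces_wf [Infinite k]
    (ψsel : (d : ℕ) → (Fin d → MvPowerSeries (Fin 2) k) → MvPowerSeries (Fin 2) k)
    (hsel : ∀ (d : ℕ) (X : Fin d → MvPowerSeries (Fin 2) k), IsPosT d X → IsPrepRecentring d X (ψsel d X))
    {β : Type} [LinearOrder β] [IsWellOrder β (· < ·)] (M : (d : ℕ) → (Fin d → MvPowerSeries (Fin 2) k) → Finset (Fin 2) → β)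
    (hM_succ : ∀ (d : ℕ) (A : Fin d → MvPowerSeries (Fin 2) k) (N : Finset (Fin 2)) (A' : Fin d → MvPowerSeries (Fin 2) k)
      (N' : Finset (Fin 2)),
      (∃ (b : MvPowerSeries (Fin (2 + 1)) k) (δ : Decoration k 2) (Θ : Fin (2 + 1) → MvPowerSeries (Fin (2 + 1)) k),
        Admissible b δ ∧ 2 ≤ δ.o ∧ δ.c = d ∧ δ.PresBy d A N Θ) →
      InPoly d A → InPoly d A' → SuccFamilySel d (ψsel d) A N A' N' → M d A' N' ≤ M d A N)
    (hM_conf : ∀ (d : ℕ) (A : Fin d → MvPowerSeries (Fin 2) k) (N : Finset (Fin 2)) (A' : Fin d → MvPowerSeries (Fin 2) k)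
      (N' : Finset (Fin 2)),
      (∃ (b : MvPowerSeries (Fin (2 + 1)) k) (δ : Decoration k 2) (Θ : Fin (2 + 1) → MvPowerSeries (Fin (2 + 1)) k),
        Admissible b δ ∧ 2 ≤ δ.o ∧ δ.c = d ∧ δ.PresBy d A N Θ) →
      InPoly d A → InPoly d A' → NCPoly.Conflict d A N → PointFamilySel d (ψsel d) A N A' N' → M d A' N' < M d A N)
    (hP1 : ∀ (b : MvPowerSeries (Fin (2 + 1)) k) (δ : Decoration k 2), Admissible b δ → 2 ≤ δ.o → ¬ δ.HCol →
      (δ.O.Nonempty ∨ δ.GoodDir) →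
      ∃ (A : Fin δ.c → MvPowerSeries (Fin 2) k) (N : Finset (Fin 2)) (Θ : Fin (2 + 1) → MvPowerSeries (Fin (2 + 1)) k),
        δ.PresBy δ.c A N Θ ∧ InPoly δ.c A)
    (hPx : ∀ (b : MvPowerSeries (Fin (2 + 1)) k) (δ : Decoration k 2) (d : ℕ) (A : Fin d → MvPowerSeries (Fin 2) k) (N : Finset (Fin 2))
      (Θ : Fin (2 + 1) → MvPowerSeries (Fin (2 + 1)) k),
      Admissible b δ → 2 ≤ δ.o → δ.c = d → δ.PresBy d A N Θ → WellPrepared d A → ¬ InPoly d A → δ.HCol)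
    (hP2' : ∀ (b : MvPowerSeries (Fin (2 + 1)) k) (δ : Decoration k 2) (d : ℕ) (A : Fin d → MvPowerSeries (Fin 2) k) (N : Finset (Fin 2))
      (Θ : Fin (2 + 1) → MvPowerSeries (Fin (2 + 1)) k),
      Admissible b δ → 2 ≤ δ.o → δ.c = d → δ.PresBy d A N Θ → InPoly d A → ¬ NCPoly.Conflict d A N →
      ∃ (Φ : Fin (2 + 1) → MvPowerSeries (Fin (2 + 1)) k) (w : Fin (2 + 1) → ℕ), IsCountMove Φ w ∧
        MoveClause b Φ w (fun b' => ∃ δ' : Decoration k 2, Admissible b' δ' ∧ (δ'.o < δ.o ∨ (δ'.head = δ.head ∧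
          ∃ (A' : Fin d → MvPowerSeries (Fin 2) k) (N' : Finset (Fin 2)) (Θ' : Fin (2 + 1) → MvPowerSeries (Fin (2 + 1)) k),
            δ'.PresBy d A' N' Θ' ∧ WellPrepared d A' ∧ SuccFamilySel d (ψsel d) A N A' N'))))
    (hP2c' : ∀ (b : MvPowerSeries (Fin (2 + 1)) k) (δ : Decoration k 2) (d : ℕ) (A : Fin d → MvPowerSeries (Fin 2) k) (N : Finset (Fin 2))
      (Θ : Fin (2 + 1) → MvPowerSeries (Fin (2 + 1)) k),
      Admissible b δ → 2 ≤ δ.o → δ.c = d → δ.PresBy d A N Θ → InPoly d A → NCPoly.Conflict d A N →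
      ∃ (Φ : Fin (2 + 1) → MvPowerSeries (Fin (2 + 1)) k) (w : Fin (2 + 1) → ℕ), IsCountMove Φ w ∧
        MoveClause b Φ w (fun b' => ∃ δ' : Decoration k 2, Admissible b' δ' ∧ (δ'.o < δ.o ∨ (δ'.head = δ.head ∧
          ∃ (A' : Fin d → MvPowerSeries (Fin 2) k) (N' : Finset (Fin 2)) (Θ' : Fin (2 + 1) → MvPowerSeries (Fin (2 + 1)) k),
            δ'.PresBy d A' N' Θ' ∧ WellPrepared d A' ∧ PointFamilySel d (ψsel d) A N A' N'))))
    (b : MvPowerSeries (Fin (2 + 1)) k) (δ : Decoration k 2) (hadm : Admissible b δ) (ho : 2 ≤ δ.o) {l : Fin (2 + 1)} (hl : δ.LetterDir l) :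
    DWinsTo (St := MvPowerSeries (Fin (2 + 1)) k × Decoration k 2) Prod.fst
      (fun τ => Admissible τ.1 τ.2 ∧ (τ.2.head < δ.head ∨ (τ.2.head = δ.head ∧ (τ.2.HCol ∨ τ.2.GoodDir ∨ τ.2.BadDir)))) (b, δ) := by
  classical
  obtain ⟨hO, hlE, hdir⟩ := hl
  -- THE FOLD `δ⁺ = (f, E, {l})`
  let δp : Decoration k 2 := ⟨δ.f, δ.E, {l}, Finset.singleton_subset_iff.mpr hlE⟩
  have hδpo : δp.o = δ.o := rfl
  have hδpc : δp.c = δ.o + 1 := by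
    have h1 : δp.c = δp.o + δp.O.card := rfl
    have h2 : δp.O.card = 1 := Finset.card_singleton l
    rw [h1, h2, hδpo]
  have hδc : δ.c = δ.o := Decoration.c_eq_o_of_O_eq_empty hO
  have hadmp : Admissible b δp := hadm
  -- `δ⁺` is outside the apex column: `in_{o+1}(f · x_l) = λ · v_l^{o+1}`
  have hdirp : δp.IsDirForm (Pi.single l 1) := by
    obtain ⟨hℓ0, la, hla, hcone⟩ := hdir
    rw [hδc, hO, Finset.prod_empty, mul_one] at hcone
    refine ⟨hℓ0, la, hla, fun v => ?_⟩
    show CobordantChart.initEval (fun _ : Fin (2 + 1) => 1) v δp.c (δ.f * ∏ l' ∈ ({l} : Finset (Fin (2 + 1))), X l') = _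
    rw [hδpc, Finset.prod_singleton, TOT2Near.initEval_mul_X, hcone, single_one_dotProduct, pow_succ, mul_assoc]
  have hncp : ¬ δp.HCol := Decoration.not_hCol_of_isDirForm hdirp
  have hnep : δp.O.Nonempty := ⟨l, Finset.mem_singleton_self l⟩
  -- the degree of the folded phase and the entry presentation
  set d : ℕ := δp.c with hd_def
  have hd : 0 < d := by omega
  obtain ⟨A₀, N₀, Θ₀, hpres₀, hin₀⟩ := hP1 b δp hadmp (hδpo ▸ ho) hncp (Or.inl hnep)
  -- THE UNFOLD `U ε = (ε.f, ε.E, ∅)` at the order of the phase, `ε` itself once the order dropped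
  let U : Decoration k 2 → Decoration k 2 := fun ε =>
    if ε.o = δ.o then ⟨ε.f, ε.E, ∅, Finset.empty_subset _⟩ else ε
  have hUeq : ∀ ε : Decoration k 2, ε.o = δ.o → (U ε).f = ε.f ∧ (U ε).E = ε.E ∧ (U ε).O = ∅ := fun ε h => by
    refine ⟨?_, ?_, ?_⟩ <;> simp only [U, if_pos h]
  have hUlt : ∀ ε : Decoration k 2, ε.o ≠ δ.o → U ε = ε := fun ε h => by simp only [U, if_neg h]
  have hUadm : ∀ (b' : MvPowerSeries (Fin (2 + 1)) k) (ε : Decoration k 2), Admissible b' ε → Admissible b' (U ε) := by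
    intro b' ε hε
    by_cases h : ε.o = δ.o
    · obtain ⟨hf, hE, -⟩ := hUeq ε h
      obtain ⟨h1, h2, h3⟩ := hε
      refine ⟨?_, ?_, ?_⟩
      · simpa [Decoration.total, hf, hE] using h1
      · rw [hf]; exact h2
      · rw [hf, hE]; exact h3
    · rw [hUlt ε h]; exact hε
  have hU0 : U δp = δ := by
    obtain ⟨hf, hE, hO'⟩ := hUeq δp hδpo
    exact Decoration.eq_of_parts hf hE (hO'.trans hO.symm)
  -- rich states, target read through `U`, region, measure
  let St : Type := (MvPowerSeries (Fin (2 + 1)) k × Decoration k 2) × ((Fin d → MvPowerSeries (Fin 2) k) × Finset (Fin 2))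
  let germ : St → MvPowerSeries (Fin (2 + 1)) k := fun σ => σ.1.1
  let Q : St → Prop := fun σ => Admissible σ.1.1 (U σ.1.2) ∧
    ((U σ.1.2).head < δ.head ∨ ((U σ.1.2).head = δ.head ∧ ((U σ.1.2).HCol ∨ (U σ.1.2).GoodDir ∨ (U σ.1.2).BadDir)))
  let C : Set St := {σ | Admissible σ.1.1 σ.1.2 ∧ σ.1.2.head = δp.head ∧
    (∃ Θ : Fin (2 + 1) → MvPowerSeries (Fin (2 + 1)) k, σ.1.2.PresBy d σ.2.1 σ.2.2 Θ) ∧ InPoly d σ.2.1}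
  let rk : (Fin d → MvPowerSeries (Fin 2) k) → Ordinal.{0} := fun A => ((wellFounded_polyRelSel (k := k) hd (hsel d)).apply A).rank
  let Λ : Ordinal.{0} := (⨆ A, rk A) + 1
  have hΛ : ∀ A, rk A < Λ := fun A => Order.lt_add_one_iff.mpr (le_ciSup (Ordinal.bddAbove_of_small (s := Set.range rk)) A)
  let μ : St → Ordinal.{0} := fun σ => Λ * Ordinal.typein (· < ·) (M d σ.2.1 σ.2.2) + rk σ.2.1
  have hlex : ∀ (t t' : Ordinal.{0}) (A A' : Fin d → MvPowerSeries (Fin 2) k), t' < t ∨ (t' = t ∧ rk A' < rk A) →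
      Λ * t' + rk A' < Λ * t + rk A := by
    rintro t t' A A' (ht | ⟨rfl, hr⟩)
    · have ht' : t' + 1 ≤ t := Order.add_one_le_of_lt ht
      calc Λ * t' + rk A' < Λ * t' + Λ := by
            gcongr
            exact hΛ A'
        _ = Λ * (t' + 1) := by rw [mul_add_one]
        _ ≤ Λ * t := by gcongr
        _ ≤ Λ * t + rk A := le_self_add
    · gcongr
  -- head bookkeeping in the folded phase
  have hoc : ∀ ε : Decoration k 2, ε.head = δp.head → ε.o = δ.o ∧ ε.c = d := by
    intro ε h
    rw [Decoration.head, Decoration.head, toLex_inj, Prod.ext_iff] at h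
    exact ⟨h.1.trans hδpo, h.2⟩
  have hOone : ∀ ε : Decoration k 2, ε.head = δp.head → ∃ l', ε.O = {l'} := by
    intro ε h
    obtain ⟨hoε, hcε⟩ := hoc ε h
    have hcard : ε.O.card = 1 := by
      have h1 : ε.c = ε.o + ε.O.card := rfl
      omega
    exact Finset.card_eq_one.mp hcard
  -- the exit for the unfold at an order drop
  have hQ_of_lt : ∀ (b' : MvPowerSeries (Fin (2 + 1)) k) (ε : Decoration k 2), Admissible b' ε → ε.o < δ.o → Q ((b', ε), (A₀, N₀)) := by
    intro b' ε hε hlt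
    refine ⟨hUadm b' ε hε, Or.inl ?_⟩
    show (U ε).head < δ.head
    rw [hUlt ε hlt.ne, Decoration.head, Decoration.head, Prod.Lex.toLex_lt_toLex]
    exact Or.inl hlt
  -- the exit for the unfold at a same-head successor outside the label regime
  have hQ_of_exit : ∀ (b' : MvPowerSeries (Fin (2 + 1)) k) (ε : Decoration k 2), Admissible b' ε → ε.head = δp.head →
      ∀ (A' : Fin d → MvPowerSeries (Fin 2) k) (N' : Finset (Fin 2)) (Θ' : Fin (2 + 1) → MvPowerSeries (Fin (2 + 1)) k),
      ε.PresBy d A' N' Θ' → WellPrepared d A' → ¬ InPoly d A' → Q ((b', ε), (A', N')) := by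
    intro b' ε hε hhead A' N' Θ' hpres hWP hnin
    obtain ⟨hoε, hcε⟩ := hoc ε hhead
    have hoε2 : 2 ≤ ε.o := by rw [hoε]; exact ho
    have hcolε : ε.HCol := hPx b' ε d A' N' Θ' hε hoε2 hcε hpres hWP hnin
    obtain ⟨l', hOl'⟩ := hOone ε hhead
    obtain ⟨hf, hE, hO'⟩ := hUeq ε hoε
    have hUo : (U ε).o = δ.o := by rw [Decoration.o, hf, show (ε.f.order).toNat = ε.o from rfl, hoε]
    have hUc : (U ε).c = δ.o := by rw [Decoration.c, hO', Finset.card_empty, add_zero, hUo]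
    refine ⟨hUadm b' ε hε, Or.inr ⟨?_, ?_⟩⟩
    · rw [Decoration.head, Decoration.head, hUo, hUc, hδc]
    · exact Decoration.hCol_or_goodDir_or_badDir_unfold hε hoε2 hOl' hcε hpres hcolε hf hE hO'
  have hσ₀ : (((b, δp), (A₀, N₀)) : St) ∈ C := ⟨hadmp, rfl, ⟨Θ₀, hpres₀⟩, hin₀⟩
  have hwin : DWinsTo germ Q (((b, δp), (A₀, N₀)) : St) := by
    refine DWinsTo.of_measure C μ ?_ hσ₀
    rintro ⟨⟨b₁, ε₁⟩, ⟨A₁, N₁⟩⟩ ⟨hadm₁, hhead₁, ⟨Θ₁, hpres₁⟩, hin₁⟩ -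
    obtain ⟨ho₁, hc₁⟩ := hoc ε₁ hhead₁
    have ho₁' : 2 ≤ ε₁.o := by rw [ho₁]; exact ho
    have hctx : ∃ (b : MvPowerSeries (Fin (2 + 1)) k) (δ : Decoration k 2) (Θ : Fin (2 + 1) → MvPowerSeries (Fin (2 + 1)) k),
        Admissible b δ ∧ 2 ≤ δ.o ∧ δ.c = d ∧ δ.PresBy d A₁ N₁ Θ := ⟨b₁, ε₁, Θ₁, hadm₁, ho₁', hc₁, hpres₁⟩
    -- a presented successor: continue (regime label, smaller measure) or exit through the unfold reader
    have hread : ∀ (b' : MvPowerSeries (Fin (2 + 1)) k) (ε' : Decoration k 2), Admissible b' ε' → ε'.head = δp.head →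
        ∀ (A' : Fin d → MvPowerSeries (Fin 2) k) (N' : Finset (Fin 2)) (Θ' : Fin (2 + 1) → MvPowerSeries (Fin (2 + 1)) k),
        ε'.PresBy d A' N' Θ' → WellPrepared d A' →
        (M d A' N' < M d A₁ N₁ ∨ (M d A' N' = M d A₁ N₁ ∧ rk A' < rk A₁) ∨ ¬ InPoly d A') →
        ∃ τ' : St, germ τ' = b' ∧ (Q τ' ∨ (τ' ∈ C ∧ μ τ' < μ ((b₁, ε₁), (A₁, N₁)))) := by
      intro b' ε' hadm' hhead' A' N' Θ' hpres' hWP' halt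
      by_cases hin' : InPoly d A'
      · rcases halt with hlt | hlt | hnin
        · exact ⟨((b', ε'), (A', N')), rfl, Or.inr ⟨⟨hadm', hhead', ⟨Θ', hpres'⟩, hin'⟩, hlex _ _ _ _ (Or.inl ((Ordinal.typein_lt_typein (· < ·)).mpr hlt))⟩⟩
        · exact ⟨((b', ε'), (A', N')), rfl, Or.inr ⟨⟨hadm', hhead', ⟨Θ', hpres'⟩, hin'⟩, hlex _ _ _ _ (Or.inr ⟨by rw [hlt.1], hlt.2⟩)⟩⟩
        · exact absurd hin' hnin
      · exact ⟨((b', ε'), (A', N')), rfl, Or.inl (hQ_of_exit b' ε' hadm' hhead' A' N' Θ' hpres' hWP' hin')⟩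
    by_cases hconf : NCPoly.Conflict d A₁ N₁
    · obtain ⟨Φ, w, hmv, hcl⟩ := hP2c' b₁ ε₁ d A₁ N₁ Θ₁ hadm₁ ho₁' hc₁ hpres₁ hin₁ hconf
      refine ⟨Φ, w, hmv, hcl.mono fun b' hb' => ?_⟩
      obtain ⟨ε', hadm', hcase⟩ := hb'
      rcases hcase with hlt | ⟨hhead', A', N', Θ', hpres', hWP', hfam⟩
      · exact ⟨((b', ε'), (A₀, N₀)), rfl, Or.inl (hQ_of_lt b' ε' hadm' (ho₁ ▸ hlt))⟩
      · refine hread b' ε' hadm' (hhead'.trans hhead₁) A' N' Θ' hpres' hWP' ?_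
        by_cases hin' : InPoly d A'
        · exact Or.inl (hM_conf d A₁ N₁ A' N' hctx hin₁ hin' hconf hfam)
        · exact Or.inr (Or.inr hin')
    · obtain ⟨Φ, w, hmv, hcl⟩ := hP2' b₁ ε₁ d A₁ N₁ Θ₁ hadm₁ ho₁' hc₁ hpres₁ hin₁ hconf
      refine ⟨Φ, w, hmv, hcl.mono fun b' hb' => ?_⟩
      obtain ⟨ε', hadm', hcase⟩ := hb'
      rcases hcase with hlt | ⟨hhead', A', N', Θ', hpres', hWP', hfam⟩
      · exact ⟨((b', ε'), (A₀, N₀)), rfl, Or.inl (hQ_of_lt b' ε' hadm' (ho₁ ▸ hlt))⟩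
      · refine hread b' ε' hadm' (hhead'.trans hhead₁) A' N' Θ' hpres' hWP' ?_
        by_cases hin' : InPoly d A'
        · have hM := hM_succ d A₁ N₁ A' N' hctx hin₁ hin' hfam
          have hrel : PolyRelSel d (ψsel d) A' A₁ := ⟨mem_succTSel_of_succFamilySel hfam, hin₁, hin'⟩
          have hrk : rk A' < rk A₁ := ((wellFounded_polyRelSel (k := k) hd (hsel d)).apply A₁).rank_lt_of_rel hrel
          rcases hM.lt_or_eq with hMlt | hMeq
          · exact Or.inl hMlt
          · exact Or.inr (Or.inl ⟨hMeq, hrk⟩)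
        · exact Or.inr (Or.inr hin')
  -- project through the unfold
  have hmap := hwin.map (germ := Prod.fst) (germ' := germ) (Q' := Q)
    (Q := fun τ : MvPowerSeries (Fin (2 + 1)) k × Decoration k 2 =>
      Admissible τ.1 τ.2 ∧ (τ.2.head < δ.head ∨ (τ.2.head = δ.head ∧ (τ.2.HCol ∨ τ.2.GoodDir ∨ τ.2.BadDir))))
    (fun σ : St => (σ.1.1, U σ.1.2)) (fun _ => rfl) (fun _ hq => hq)
  simpa only [hU0] using hmap

end TameFourTupleDrop

end Summit.ResolutionOfSingularities.ResolutionOfSingularities.Theorems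

end
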